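import Summits.ValiantsHypothesis.ValiantsHypothesis.Theorems.LacunarySymmetroidMatrixDescartesChainInertia

/-!
# `MatrixDescartes` census — BLOCK CALCULUS for mixed chains (packaged certificates with Sylvester data at both ends)

HONEST FRAMING.  Object-search cell `pub-symmetroid`, crux `Theses.LacunarySymmetroid.MatrixDescartes`
(stmt-ValiantsHypothesis-18050); seat val-sym-mdr-p1 (g8).  LOWER-bound / construction mathematics in census (CONJECTURE-A)
currency; it proves NOTHING about the crux `MatrixDescartes` (an UPPER-bound statement at fat formats), nothing about
`DoorA26` / `DoorA34`, nothing about `VP ≠ VNP`.  No definitions.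

A BLOCK is an alternation certificate on a strictly increasing support, packaged as one `∃` statement together with the SYLVESTER FORMS
of its bottom and top letters (`Cᵀ T_bottom C = diagonal q`, `Cᵀ T_top C = diagonal r`, invertible `C`); a CHAIN records only the top form.
This file is the calculus the mixed-chain files use: `block_of_certificate` (package an explicit census certificate from its closed form,
test points and two RATIONAL congruence diagonalisations, normalising the diagonal to any sign-matched vector), `block_smul` (scale a block,
e.g. by `−1`), `chain_of_block`, `chain_append` (the junction law for matching junction inertia, `Chain.exists_alternating_junction_inertia`:
append a block whose bottom form matches the chain's top form up to a permutation); rows are read off by `Chain.not_posRootLawAt_of_certificateT`.  The cell's record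
certificates become blocks in `…ChainBlock<X>.lean`; their mixed chains (e.g. `F18 ▹ T27`: `ζ_sym(3,8) ≥ 45`) in `…ChainMix*.lean`.
[folklore] throughout.
-/

-- `Summit.ValiantsHypothesis.ValiantsHypothesis.…` repeats a component by the D-0017 layout
-- (single-conjunct summit), which the `dupNamespace` linter flags; the name is mandated.
set_option linter.dupNamespace false

namespace Summit.ValiantsHypothesis.ValiantsHypothesis.Theorems.LacunarySymmetroidMatrixDescartes.Census.Chain

open Matrix Finset Filter Topology
open scoped BigOperators
open Summit.ValiantsHypothesis.ValiantsHypothesis.Theorems.LacunarySymmetroidMatrixDescartes.Census.Graft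
open Summit.ValiantsHypothesis.ValiantsHypothesis.Theorems.MatrixDescartes.Negative (PosRootLawAt)

/-! ### Sylvester forms: normalisation of the diagonal -/

/-- **Normalising a Sylvester form**: if `Cᵀ A C = diagonal p` (`C` invertible) and `s` has the signs of `p` (`p i · s i > 0`), then also
`C'ᵀ A C' = diagonal s` for some invertible `C'` (rescale the columns by `√(s i / p i)`). [folklore] -/
theorem exists_congr_diagonal_signs {m : ℕ} {A : Matrix (Fin m) (Fin m) ℝ} {p : Fin m → ℝ}
    (hA : ∃ C : Matrix (Fin m) (Fin m) ℝ, C.det ≠ 0 ∧ Cᵀ * A * C = diagonal p) (s : Fin m → ℝ)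
    (hps : ∀ i, 0 < p i * s i) :
    ∃ C : Matrix (Fin m) (Fin m) ℝ, C.det ≠ 0 ∧ Cᵀ * A * C = diagonal s := by
  have h1 : ∃ C : Matrix (Fin m) (Fin m) ℝ, C.det ≠ 0 ∧ Cᵀ * diagonal s * C = diagonal s :=
    ⟨1, by simp, by rw [transpose_one, Matrix.one_mul, Matrix.mul_one]⟩
  exact exists_congr_of_diagonal h1 hA (Equiv.refl _) fun i => by rw [Equiv.refl_apply, mul_comm]; exact hps i

/-! ### Packaging an explicit certificate as a block -/

/-- **Block packer.**  An explicit census certificate — closed form `q` of `det (∑ t^(d l) • S l)` (`K+1` letters, strictly increasing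
support), symmetric letters, strictly increasing positive test points with strict sign alternation of `q` (`N ≥ 1` alternations) — together
with RATIONAL congruence diagonalisations of its bottom and top letters (`Cbᵀ S_0 Cb = diagonal pb`, `Ctᵀ S_K Ct = diagonal pt`, invertible) and
sign-matched target vectors `sb, st` (`pb i · sb i > 0`, `pt i · st i > 0`; typically `±1` entries) is a BLOCK with bottom form `diagonal sb`
and top form `diagonal st`. [folklore] -/
theorem block_of_certificate {m K N : ℕ} {d : Fin (K + 1) → ℕ} {S : Fin (K + 1) → Matrix (Fin m) (Fin m) ℝ} {q : ℝ → ℝ}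
    (hq : ∀ t : ℝ, (∑ l, t ^ d l • S l).det = q t) (hd : StrictMono d) (hS : ∀ l, (S l).IsSymm)
    (τ : Fin (N + 1) → ℝ) (hτ : StrictMono τ) (hpos : ∀ j, 0 < τ j)
    (halt : ∀ j : Fin N, q (τ j.castSucc) * q (τ j.succ) < 0) (hN : 1 ≤ N)
    (Cb : Matrix (Fin m) (Fin m) ℝ) (hCb : Cb.det ≠ 0) (pb : Fin m → ℝ) (hCbe : Cbᵀ * S 0 * Cb = diagonal pb)
    (sb : Fin m → ℝ) (hsb : ∀ i, 0 < pb i * sb i)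
    (Ct : Matrix (Fin m) (Fin m) ℝ) (hCt : Ct.det ≠ 0) (pt : Fin m → ℝ) (hCte : Ctᵀ * S (Fin.last K) * Ct = diagonal pt)
    (st : Fin m → ℝ) (hst : ∀ i, 0 < pt i * st i) :
    ∃ (e : Fin (K + 1) → ℕ) (T : Fin (K + 1) → Matrix (Fin m) (Fin m) ℝ) (σ : Fin (N + 1) → ℝ),
      StrictMono e ∧
      (∀ h1 : 0 < K + 1, ∃ C : Matrix (Fin m) (Fin m) ℝ, C.det ≠ 0 ∧ Cᵀ * T ⟨0, h1⟩ * C = diagonal sb) ∧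
      (∀ h1 : 0 < K + 1, ∃ C : Matrix (Fin m) (Fin m) ℝ, C.det ≠ 0 ∧
        Cᵀ * T ⟨K + 1 - 1, Nat.sub_lt h1 one_pos⟩ * C = diagonal st) ∧
      (∀ l, (T l).IsSymm) ∧ StrictMono σ ∧ (∀ j, 0 < σ j) ∧ (∀ j, (∑ l, σ j ^ e l • T l).det ≠ 0) ∧
      ∀ j : Fin N, (∑ l, σ j.castSucc ^ e l • T l).det * (∑ l, σ j.succ ^ e l • T l).det < 0 := by
  have halt' : ∀ j : Fin N, (∑ l, τ j.castSucc ^ d l • S l).det * (∑ l, τ j.succ ^ d l • S l).det < 0 := fun j => by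
    rw [hq, hq]; exact halt j
  have hne : ∀ j, (∑ l, τ j ^ d l • S l).det ≠ 0 := ne_zero_of_alternating hN (fun j => (∑ l, τ j ^ d l • S l).det) halt'
  refine ⟨d, S, τ, hd, fun h1 => ?_, fun h1 => ?_, hS, hτ, hpos, hne, halt'⟩
  · have hidx : (⟨0, h1⟩ : Fin (K + 1)) = 0 := rfl
    rw [hidx]
    exact exists_congr_diagonal_signs ⟨Cb, hCb, hCbe⟩ sb hsb
  · have hidx : (⟨K + 1 - 1, Nat.sub_lt h1 one_pos⟩ : Fin (K + 1)) = Fin.last K := Fin.ext rfl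
    rw [hidx]
    exact exists_congr_diagonal_signs ⟨Ct, hCt, hCte⟩ st hst

/-- **Scaling a block** by `c ≠ 0` (in particular `c = −1`): letters `c • T l`, forms `c • q`, `c • r`. [folklore] -/
theorem block_smul {m n N : ℕ} {q r : Fin m → ℝ}
    (h : ∃ (e : Fin n → ℕ) (T : Fin n → Matrix (Fin m) (Fin m) ℝ) (σ : Fin (N + 1) → ℝ),
      StrictMono e ∧
      (∀ h1 : 0 < n, ∃ C : Matrix (Fin m) (Fin m) ℝ, C.det ≠ 0 ∧ Cᵀ * T ⟨0, h1⟩ * C = diagonal q) ∧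
      (∀ h1 : 0 < n, ∃ C : Matrix (Fin m) (Fin m) ℝ, C.det ≠ 0 ∧
        Cᵀ * T ⟨n - 1, Nat.sub_lt h1 one_pos⟩ * C = diagonal r) ∧
      (∀ l, (T l).IsSymm) ∧ StrictMono σ ∧ (∀ j, 0 < σ j) ∧ (∀ j, (∑ l, σ j ^ e l • T l).det ≠ 0) ∧
      ∀ j : Fin N, (∑ l, σ j.castSucc ^ e l • T l).det * (∑ l, σ j.succ ^ e l • T l).det < 0)
    (c : ℝ) (hc : c ≠ 0) :
    ∃ (e : Fin n → ℕ) (T : Fin n → Matrix (Fin m) (Fin m) ℝ) (σ : Fin (N + 1) → ℝ),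
      StrictMono e ∧
      (∀ h1 : 0 < n, ∃ C : Matrix (Fin m) (Fin m) ℝ, C.det ≠ 0 ∧ Cᵀ * T ⟨0, h1⟩ * C = diagonal (c • q)) ∧
      (∀ h1 : 0 < n, ∃ C : Matrix (Fin m) (Fin m) ℝ, C.det ≠ 0 ∧
        Cᵀ * T ⟨n - 1, Nat.sub_lt h1 one_pos⟩ * C = diagonal (c • r)) ∧
      (∀ l, (T l).IsSymm) ∧ StrictMono σ ∧ (∀ j, 0 < σ j) ∧ (∀ j, (∑ l, σ j ^ e l • T l).det ≠ 0) ∧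
      ∀ j : Fin N, (∑ l, σ j.castSucc ^ e l • T l).det * (∑ l, σ j.succ ^ e l • T l).det < 0 := by
  obtain ⟨e, T, σ, he, hb, ht, hT, hσ, hpos, hne, halt⟩ := h
  obtain ⟨hT', hne', halt'⟩ := alternating_smul e T hT c hc σ hne halt
  exact ⟨e, fun l => c • T l, σ, he, fun h1 => exists_congr_diagonal_smul (hb h1) c,
    fun h1 => exists_congr_diagonal_smul (ht h1) c, hT', hσ, hpos, hne', halt'⟩

/-! ### Chains: start, append, read off the row -/

/-- **A block starts a chain** (forget the bottom form). [folklore] -/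
theorem chain_of_block {m n N : ℕ} {q r : Fin m → ℝ}
    (h : ∃ (e : Fin n → ℕ) (T : Fin n → Matrix (Fin m) (Fin m) ℝ) (σ : Fin (N + 1) → ℝ),
      StrictMono e ∧
      (∀ h1 : 0 < n, ∃ C : Matrix (Fin m) (Fin m) ℝ, C.det ≠ 0 ∧ Cᵀ * T ⟨0, h1⟩ * C = diagonal q) ∧
      (∀ h1 : 0 < n, ∃ C : Matrix (Fin m) (Fin m) ℝ, C.det ≠ 0 ∧
        Cᵀ * T ⟨n - 1, Nat.sub_lt h1 one_pos⟩ * C = diagonal r) ∧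
      (∀ l, (T l).IsSymm) ∧ StrictMono σ ∧ (∀ j, 0 < σ j) ∧ (∀ j, (∑ l, σ j ^ e l • T l).det ≠ 0) ∧
      ∀ j : Fin N, (∑ l, σ j.castSucc ^ e l • T l).det * (∑ l, σ j.succ ^ e l • T l).det < 0) :
    ∃ (e : Fin n → ℕ) (T : Fin n → Matrix (Fin m) (Fin m) ℝ) (σ : Fin (N + 1) → ℝ),
      StrictMono e ∧
      (∀ h1 : 0 < n, ∃ C : Matrix (Fin m) (Fin m) ℝ, C.det ≠ 0 ∧
        Cᵀ * T ⟨n - 1, Nat.sub_lt h1 one_pos⟩ * C = diagonal r) ∧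
      (∀ l, (T l).IsSymm) ∧ StrictMono σ ∧ (∀ j, 0 < σ j) ∧ (∀ j, (∑ l, σ j ^ e l • T l).det ≠ 0) ∧
      ∀ j : Fin N, (∑ l, σ j.castSucc ^ e l • T l).det * (∑ l, σ j.succ ^ e l • T l).det < 0 := by
  obtain ⟨e, T, σ, he, -, ht, hT, hσ, hpos, hne, halt⟩ := h
  exact ⟨e, T, σ, he, ht, hT, hσ, hpos, hne, halt⟩

/-- **Appending a block to a chain** (the junction law for matching junction inertia): a chain with `K₁+1` letters, `N₁` alternations
and top form `diagonal p`, and a block with `K₂+1` letters (`K₂ ≥ 1`), `N₂` alternations, bottom form `diagonal q`, top form `diagonal r`,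
with `p i · q (π i) > 0` for a permutation `π`, give a chain with `K₁ + K₂ + 1` letters, `N₁ + N₂` alternations and top form
`diagonal r`. [folklore] -/
theorem chain_append {m K₁ K₂ N₁ N₂ : ℕ} (hK₂ : 0 < K₂) {p q r : Fin m → ℝ}
    (hP : ∃ (d : Fin (K₁ + 1) → ℕ) (S : Fin (K₁ + 1) → Matrix (Fin m) (Fin m) ℝ) (τ : Fin (N₁ + 1) → ℝ),
      StrictMono d ∧ (∀ h1 : 0 < K₁ + 1, ∃ C : Matrix (Fin m) (Fin m) ℝ, C.det ≠ 0 ∧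
        Cᵀ * S ⟨K₁ + 1 - 1, Nat.sub_lt h1 one_pos⟩ * C = diagonal p) ∧
      (∀ l, (S l).IsSymm) ∧ StrictMono τ ∧ (∀ j, 0 < τ j) ∧ (∀ j, (∑ l, τ j ^ d l • S l).det ≠ 0) ∧
      ∀ j : Fin N₁, (∑ l, τ j.castSucc ^ d l • S l).det * (∑ l, τ j.succ ^ d l • S l).det < 0)
    (hQ : ∃ (e : Fin (K₂ + 1) → ℕ) (T : Fin (K₂ + 1) → Matrix (Fin m) (Fin m) ℝ) (σ : Fin (N₂ + 1) → ℝ),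
      StrictMono e ∧
      (∀ h1 : 0 < K₂ + 1, ∃ C : Matrix (Fin m) (Fin m) ℝ, C.det ≠ 0 ∧ Cᵀ * T ⟨0, h1⟩ * C = diagonal q) ∧
      (∀ h1 : 0 < K₂ + 1, ∃ C : Matrix (Fin m) (Fin m) ℝ, C.det ≠ 0 ∧
        Cᵀ * T ⟨K₂ + 1 - 1, Nat.sub_lt h1 one_pos⟩ * C = diagonal r) ∧
      (∀ l, (T l).IsSymm) ∧ StrictMono σ ∧ (∀ j, 0 < σ j) ∧ (∀ j, (∑ l, σ j ^ e l • T l).det ≠ 0) ∧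
      ∀ j : Fin N₂, (∑ l, σ j.castSucc ^ e l • T l).det * (∑ l, σ j.succ ^ e l • T l).det < 0)
    (π : Equiv.Perm (Fin m)) (hpq : ∀ i, 0 < p i * q (π i)) :
    ∃ (d : Fin (K₁ + K₂ + 1) → ℕ) (S : Fin (K₁ + K₂ + 1) → Matrix (Fin m) (Fin m) ℝ) (τ : Fin (N₁ + N₂ + 1) → ℝ),
      StrictMono d ∧ (∀ h1 : 0 < K₁ + K₂ + 1, ∃ C : Matrix (Fin m) (Fin m) ℝ, C.det ≠ 0 ∧
        Cᵀ * S ⟨K₁ + K₂ + 1 - 1, Nat.sub_lt h1 one_pos⟩ * C = diagonal r) ∧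
      (∀ l, (S l).IsSymm) ∧ StrictMono τ ∧ (∀ j, 0 < τ j) ∧ (∀ j, (∑ l, τ j ^ d l • S l).det ≠ 0) ∧
      ∀ j : Fin (N₁ + N₂), (∑ l, τ j.castSucc ^ d l • S l).det * (∑ l, τ j.succ ^ d l • S l).det < 0 := by
  obtain ⟨e, T, σ, he, hb, ht, hT, hσ, hσpos, hne', halt'⟩ := hQ
  have hq : ∃ C : Matrix (Fin m) (Fin m) ℝ, C.det ≠ 0 ∧ Cᵀ * T 0 * C = diagonal q := hb (Nat.succ_pos K₂)
  have hr : ∃ C : Matrix (Fin m) (Fin m) ℝ, C.det ≠ 0 ∧ Cᵀ * T (Fin.last K₂) * C = diagonal r := by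
    have h := ht (Nat.succ_pos K₂)
    have hidx : (⟨K₂ + 1 - 1, Nat.sub_lt (Nat.succ_pos K₂) one_pos⟩ : Fin (K₂ + 1)) = Fin.last K₂ := Fin.ext rfl
    rw [hidx] at h
    exact h
  exact exists_alternating_appendT hK₂ hP e T he hT σ hσ hσpos hne' halt' hq hr π hpq

/-- **Reading off the row from a block.** [folklore] -/
theorem not_posRootLawAt_of_block {m n N : ℕ} {q r : Fin m → ℝ} (hN : 1 ≤ N)
    (h : ∃ (e : Fin n → ℕ) (T : Fin n → Matrix (Fin m) (Fin m) ℝ) (σ : Fin (N + 1) → ℝ),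
      StrictMono e ∧
      (∀ h1 : 0 < n, ∃ C : Matrix (Fin m) (Fin m) ℝ, C.det ≠ 0 ∧ Cᵀ * T ⟨0, h1⟩ * C = diagonal q) ∧
      (∀ h1 : 0 < n, ∃ C : Matrix (Fin m) (Fin m) ℝ, C.det ≠ 0 ∧
        Cᵀ * T ⟨n - 1, Nat.sub_lt h1 one_pos⟩ * C = diagonal r) ∧
      (∀ l, (T l).IsSymm) ∧ StrictMono σ ∧ (∀ j, 0 < σ j) ∧ (∀ j, (∑ l, σ j ^ e l • T l).det ≠ 0) ∧
      ∀ j : Fin N, (∑ l, σ j.castSucc ^ e l • T l).det * (∑ l, σ j.succ ^ e l • T l).det < 0) :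
    ¬ PosRootLawAt m n (N - 1) :=
  not_posRootLawAt_of_certificateT hN (chain_of_block h)

end Summit.ValiantsHypothesis.ValiantsHypothesis.Theorems.LacunarySymmetroidMatrixDescartes.Census.Chain
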